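import Literature.NumberTheory.EllipticCurves.ModPImageTransvectionCriterionProofs
import Literature.NumberTheory.EllipticCurves.TateModuleFree
import Literature.NumberTheory.EllipticCurves.TateModuleProjSurjectiveProofs
import HarnessLib

/-!
# Hypothesis (im) fails on the `p`-adic Tate module at an irreducible, non-surjective prime

Topic `NumberTheory/EllipticCurves`; theorems only (nothing is defined, no named fact).  Sequel of
`ModPImageTransvectionCriterionProofs`, lifting its mod-`p` statement to the `p`-adic Tate module
`T = T_pE` (`WeierstrassCurve.tateModule`, `TateModule`), i.e. to the LITERAL hypothesis

> (im) there exists an element `σ ∈ G_{ℚ(μ_{p^∞})}` such that `T/(σ - 1)T ≃ ℤ_p`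

of Burungale–Castella–Skinner, *Base change and Iwasawa Main Conjectures for GL₂*, IMRN 2025
(rnaf082) = arXiv:2405.00270v2, p. 2 (hypothesis of Thm. 1.1.2 (b) and Cor. 1.3.1) — which is
Kato's hypothesis in *Astérisque* 295 (2004), Thm. 13.4 (3) ("there exists an element `σ` of
`Gal(ℚ̄/ℚ(ζ_{p^∞}))` such that `Coker(1 - σ : T → T)` is a free `O_L`-module of rank 1") and
Skinner's (b), Pacific J. Math. 283 (2016), §2.5.

**Theorem** (`WeierstrassCurve.isEmpty_quotient_range_galoisRepTate_sub_one_equiv`).  Let `E = W/ℚ`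
be an elliptic curve and `p` a prime such that `E[p]` is irreducible and `ρ̄_{E,p}` is not
surjective.  Then for every `σ ∈ Γ_ℚ` fixing all `p`-power roots of unity of `ℚ̄`, the
`ℤ_p`-module `T_pE/(σ - 1)T_pE` is NOT isomorphic to `ℤ_p`.  So (im) is false for such `(E, p)`:
the integral main-conjecture / BSD-formula statements of BCS 2025 (Thm. 1.1.2 (b), Cor. 1.3.1),
Kato (Thm. 17.4 (3)) and Skinner 2016 (Thm. C, footnote) have an unsatisfiable hypothesis exactly
on the "residually small but irreducible" images — the class X9 of the BSD rank-≤1 residual census.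

Proof: reduction modulo `p`.  The first projection `π : T_pE → E[p]` is onto
(`proj_surjective_of_isAlgClosed_holds`) with kernel `p T_pE` (`TateModule.p_smul_div`) and is
`Γ_ℚ`-equivariant, so it induces `T/((σ-1)T + pT) ≅ E[p]/(σ - 1)E[p]`; if `T/(σ - 1)T ≅ ℤ_p` the
left side is `ℤ_p/p ≅ 𝔽_p`, so `#(E[p]/(σ - 1)E[p]) = p`, contradicting
`natCard_quotient_range_sub_id_ne_of_forall_smul_eq` (`ModPImageTransvectionCriterionProofs`: such
a `σ` would act on `E[p]` by a transvection of order `p`, and Serre's Prop. 15 would make the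
image Borel or all of `GL₂(𝔽_p)`).  The counting is done by hand: `E[p]/(σ-1)E[p]` is cyclic,
generated by the image `x₀` of a lift `t₀ ∈ T` of a generator of `T/(σ-1)T`, and `m • x₀ = 0`
forces `p ∣ m` (apply the isomorphism with `ℤ_p` and reduce mod `p`), so it has exactly `p`
elements (`Nat.card_zmultiples`, `addOrderOf_eq_prime`).

## References

* [BurungaleCastellaSkinner2025] A. Burungale, F. Castella, C. Skinner, IMRN 2025 (rnaf082) =
  arXiv:2405.00270v2, p. 2 (im), Rem. 1.1.3 (iii), p. 4 Cor. 1.3.1, p. 10 (proof of Thm. 1.1.2: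
  "(5.4) in `Λ` if hypothesis (im) holds, and in `Λ ⊗ ℚ_p` otherwise").
* [Kato2004] K. Kato, Astérisque 295 (2004), Thm. 13.4 (3); (12.5.2); Thm. 17.4 (3).
* [Skinner2016PacificMC] C. Skinner, Pacific J. Math. 283 (2016), §2.5 (a), (b).
* [Serre1972] J.-P. Serre, Invent. Math. 15 (1972), §2.4 Prop. 15.
* [SilvermanAEC2009] J. H. Silverman, *AEC*, III.§7 (`T_ℓ E`, `T_ℓ E / ℓ = E[ℓ]`).
-/

noncomputable section

open scoped Classical
open Field

namespace WeierstrassCurve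

open Literature.NumberTheory.EllipticCurves

variable (W : WeierstrassCurve ℚ) [W.IsElliptic] (p : ℕ) [Fact p.Prime]

/-- **(im) fails at an irreducible, non-surjective prime.**  For an elliptic curve `E = W/ℚ` and a
prime `p` with `E[p]` irreducible and `ρ̄_{E,p}` not surjective, and any `σ ∈ Γ_ℚ` acting
trivially on all `p`-power roots of unity (`σ ∈ G_{ℚ(μ_{p^∞})}`), the cokernel of `σ - 1` on the
`p`-adic Tate module `T_pE` is not isomorphic to `ℤ_p` as a `ℤ_p`-module: hypothesis (im) of
Burungale–Castella–Skinner 2025 (= Kato 2004, Thm. 13.4 (3); Skinner 2016, §2.5 (b)) is violated by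
every Galois element.  (Reduction mod `p` of such an isomorphism would give
`#(E[p]/(σ-1)E[p]) = p`, excluded by `natCard_quotient_range_sub_id_ne_of_forall_smul_eq`.)
[cite: BurungaleCastellaSkinner2025, hypothesis (im), Rem. 1.1.3 (iii)] -/
theorem isEmpty_quotient_range_galoisRepTate_sub_one_equiv
    (hirr : W.HasIrreducibleModPGaloisRep p) (hns : ¬ W.HasSurjectiveModNGaloisRep p)
    (σ : absoluteGaloisGroup ℚ)
    (hσ : ∀ (n : ℕ) (t : AlgebraicClosure ℚ), t ^ p ^ n = 1 → σ • t = t) :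
    IsEmpty (((W.tateModule p) ⧸ LinearMap.range (W.galoisRepTate p σ - 1)) ≃ₗ[ℤ_[p]] ℤ_[p]) := by
  have hp : p.Prime := Fact.out
  refine ⟨fun Ψ => ?_⟩
  -- notation
  set T := W.tateModule p
  set S : Submodule ℤ_[p] (W.tateModule p) := LinearMap.range (W.galoisRepTate p σ - 1) with hS_def
  set f : geomTorsion W p →+ geomTorsion W p :=
    (Multiplicative.toAdd (galoisRepTorsion W p σ)).toAddMonoidHom -
      AddMonoidHom.id (geomTorsion W p) with hf
  set R : AddSubgroup (geomTorsion W p) := f.range with hR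
  -- the reduction map `π : T_pE → E[p]` (first projection)
  have hmem : ∀ a : W.tateModule p, TateModule.proj p 1 a ∈ geomTorsion W p := fun a => by
    have h := proj_tateModule_mem_geomTorsion W p 1 a
    rwa [pow_one] at h
  set π : W.tateModule p →+ geomTorsion W p :=
    (TateModule.proj p 1).codRestrict (geomTorsion W p) hmem with hπ
  have hπval : ∀ a, (π a : geomPoints W) = TateModule.proj p 1 a := fun a => rfl
  have hπsurj : Function.Surjective π := by
    intro P
    have hP : (P : geomPoints W) ∈ geomTorsion W (p ^ 1 : ℕ) := by rw [pow_one]; exact P.2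
    obtain ⟨a, ha⟩ := proj_surjective_of_isAlgClosed_holds W p 1 hP
    exact ⟨a, Subtype.ext ha⟩
  have hπker : ∀ a, π a = 0 → ∃ b : W.tateModule p, a = (p : ℤ_[p]) • b := by
    intro a ha
    have h0 : TateModule.proj p 1 a = 0 := by
      rw [← hπval a, ha, ZeroMemClass.coe_zero]
    exact ⟨TateModule.div a h0, (TateModule.p_smul_div a h0).symm⟩
  have hπsmul : ∀ a, π (σ • a) = σ • π a := fun a => Subtype.ext rfl
  -- `E[p]` is `p`-torsion
  have hpE : ∀ e : geomTorsion W p, p • e = 0 := by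
    intro e
    apply Subtype.ext
    have he : ((p : ℤ) • (e : geomPoints W)) = 0 :=
      (Submodule.mem_torsionBy_iff _ _).mp e.2
    rw [AddSubmonoidClass.coe_nsmul, ZeroMemClass.coe_zero, ← natCast_zsmul, he]
  -- `ψ = mk ∘ π : T → E[p]/R`
  set ψ : W.tateModule p →+ geomTorsion W p ⧸ R := (QuotientAddGroup.mk' R).comp π with hψ
  have hψ_apply : ∀ a, ψ a = QuotientAddGroup.mk (π a) := fun a => rfl
  -- Claim A: `ψ` kills `S = (σ - 1)T`
  have hfπ : ∀ b : W.tateModule p, f (π b) = π (σ • b - b) := by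
    intro b
    rw [map_sub, hπsmul, hf, AddMonoidHom.sub_apply, AddMonoidHom.id_apply,
      AddEquiv.coe_toAddMonoidHom]
    rfl
  have hsub_mem : ∀ b : W.tateModule p, σ • b - b ∈ S := by
    intro b
    refine ⟨b, ?_⟩
    rw [LinearMap.sub_apply, galoisRepTate_apply_apply, Module.End.one_apply]
  have hA : ∀ a ∈ S, ψ a = 0 := by
    rintro a ⟨b, rfl⟩
    rw [hψ_apply, QuotientAddGroup.eq_zero_iff, LinearMap.sub_apply, galoisRepTate_apply_apply,
      Module.End.one_apply, ← hfπ]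
    exact ⟨π b, rfl⟩
  -- Claim B: `ψ` kills `pT`
  have hB : ∀ a : W.tateModule p, ψ ((p : ℤ_[p]) • a) = 0 := by
    intro a
    rw [Nat.cast_smul_eq_nsmul, hψ_apply, map_nsmul, hpE, QuotientAddGroup.mk_zero]
  -- Claim C: exactness — `ψ a = 0` forces `a ∈ S + pT`
  have hC : ∀ a : W.tateModule p, ψ a = 0 →
      ∃ s ∈ S, ∃ b : W.tateModule p, a = s + (p : ℤ_[p]) • b := by
    intro a ha
    rw [hψ_apply, QuotientAddGroup.eq_zero_iff] at ha
    obtain ⟨e, he⟩ := ha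
    obtain ⟨b, rfl⟩ := hπsurj e
    rw [hfπ] at he
    have hker : π (a - (σ • b - b)) = 0 := by rw [map_sub, he, sub_self]
    obtain ⟨c, hc⟩ := hπker _ hker
    exact ⟨σ • b - b, hsub_mem b, c, by rw [← hc]; abel⟩
  -- a generator `t₀` of `T/S ≅ ℤ_p`
  obtain ⟨t₀, ht₀⟩ := Submodule.Quotient.mk_surjective S (Ψ.symm 1)
  have hQ1 : ∀ a : W.tateModule p, ∃ c : ℤ_[p], a - c • t₀ ∈ S := by
    intro a
    refine ⟨Ψ (Submodule.Quotient.mk a), (Submodule.Quotient.eq S).mp ?_⟩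
    rw [Submodule.Quotient.mk_smul, ht₀]
    apply Ψ.injective
    rw [map_smul, LinearEquiv.apply_symm_apply, smul_eq_mul, mul_one]
  have hQ2 : ∀ m : ℕ, (∃ s ∈ S, ∃ b : W.tateModule p,
      ((m : ℤ_[p]) • t₀ : W.tateModule p) = s + (p : ℤ_[p]) • b) → p ∣ m := by
    rintro m ⟨s, hs, b, hb⟩
    have h1 : (m : ℤ_[p]) • Submodule.Quotient.mk (p := S) t₀ =
        (p : ℤ_[p]) • Submodule.Quotient.mk (p := S) b := by
      rw [← Submodule.Quotient.mk_smul, hb, Submodule.Quotient.mk_add,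
        (Submodule.Quotient.mk_eq_zero S).mpr hs, zero_add, Submodule.Quotient.mk_smul]
    have h2 := congrArg Ψ h1
    rw [map_smul, map_smul, ht₀, LinearEquiv.apply_symm_apply, smul_eq_mul, mul_one,
      smul_eq_mul] at h2
    have h3 := congrArg (PadicInt.toZMod (p := p)) h2
    rw [map_natCast, map_mul, map_natCast, ZMod.natCast_self, zero_mul] at h3
    exact (ZMod.natCast_eq_zero_iff m p).mp h3
  -- every `c ∈ ℤ_p` is `m + p c'` with `m ∈ ℕ`
  have hdecomp : ∀ c : ℤ_[p], ∃ (m : ℕ) (c' : ℤ_[p]), c = m + p * c' := by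
    intro c
    refine ⟨(PadicInt.toZMod c).val, ?_⟩
    have hk : c - ((PadicInt.toZMod c).val : ℤ_[p]) ∈ RingHom.ker (PadicInt.toZMod (p := p)) := by
      rw [RingHom.mem_ker, map_sub, map_natCast, ZMod.natCast_zmod_val, sub_self]
    rw [PadicInt.ker_toZMod, PadicInt.maximalIdeal_eq_span_p, Ideal.mem_span_singleton] at hk
    obtain ⟨c', hc'⟩ := hk
    exact ⟨c', by rw [← hc']; abel⟩
  -- the generator `x₀ = ψ t₀` of `E[p]/R`
  set x₀ : geomTorsion W p ⧸ R := ψ t₀ with hx₀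
  have hψsmul : ∀ c : ℤ_[p], ∃ m : ℕ, ψ (c • t₀) = m • x₀ := by
    intro c
    obtain ⟨m, c', rfl⟩ := hdecomp c
    refine ⟨m, ?_⟩
    rw [add_smul, map_add, mul_smul, hB, add_zero, Nat.cast_smul_eq_nsmul, map_nsmul]
  have hgen : ∀ y : geomTorsion W p ⧸ R, ∃ m : ℕ, y = m • x₀ := by
    intro y
    obtain ⟨e, rfl⟩ := QuotientAddGroup.mk_surjective y
    obtain ⟨a, rfl⟩ := hπsurj e
    obtain ⟨c, hc⟩ := hQ1 a
    obtain ⟨m, hm⟩ := hψsmul c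
    refine ⟨m, ?_⟩
    rw [← hm, ← hψ_apply, ← sub_eq_zero, ← map_sub]
    exact hA _ hc
  have horder : ∀ m : ℕ, m • x₀ = 0 → p ∣ m := by
    intro m hm
    apply hQ2 m
    apply hC
    rw [Nat.cast_smul_eq_nsmul, map_nsmul]
    exact hm
  have hx₀ne : x₀ ≠ 0 := by
    intro h0
    have := horder 1 (by rw [one_smul]; exact h0)
    exact hp.one_lt.ne' (Nat.dvd_one.mp this)
  have hpx₀ : p • x₀ = 0 := by
    rw [hx₀, ← map_nsmul, ← Nat.cast_smul_eq_nsmul ℤ_[p], hB]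
  have hord : addOrderOf x₀ = p := addOrderOf_eq_prime hpx₀ hx₀ne
  have htop : AddSubgroup.zmultiples x₀ = ⊤ := by
    rw [eq_top_iff]
    intro y _
    obtain ⟨m, rfl⟩ := hgen y
    exact (AddSubgroup.zmultiples x₀).nsmul_mem (AddSubgroup.mem_zmultiples x₀) m
  have hcard : Nat.card (geomTorsion W p ⧸ R) = p := by
    rw [← AddSubgroup.card_top, ← htop, Nat.card_zmultiples, hord]
  exact natCard_quotient_range_sub_id_ne_of_forall_smul_eq W p hirr hns σ hσ hcard

/-- **Corollary (the shape of BCS's (im)).**  Under the same hypotheses there is NO `σ ∈ Γ_ℚ`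
fixing all `p`-power roots of unity with `T_pE/(σ - 1)T_pE ≃ ℤ_p`: hypothesis (im) of
Burungale–Castella–Skinner 2025, Thm. 1.1.2 (b) / Cor. 1.3.1 is false for `(E, p)`.
[cite: BurungaleCastellaSkinner2025, hypothesis (im)] -/
theorem not_exists_galoisRepTate_quotient_equiv
    (hirr : W.HasIrreducibleModPGaloisRep p) (hns : ¬ W.HasSurjectiveModNGaloisRep p) :
    ¬ ∃ σ : absoluteGaloisGroup ℚ,
      (∀ (n : ℕ) (t : AlgebraicClosure ℚ), t ^ p ^ n = 1 → σ • t = t) ∧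
        Nonempty (((W.tateModule p) ⧸ LinearMap.range (W.galoisRepTate p σ - 1)) ≃ₗ[ℤ_[p]] ℤ_[p]) := by
  rintro ⟨σ, hσ, ⟨Ψ⟩⟩
  exact (isEmpty_quotient_range_galoisRepTate_sub_one_equiv W p hirr hns σ hσ).false Ψ

end WeierstrassCurve
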